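import Summits.Ventures.Crystal3D.Theorems.StickyWulffConstantGenericWallFloorStackWalkStarExclusion
import HarnessLib

/-!
# Pricing coincident walk ends: a ball carrying `k` pairwise non-co-axial closed stars among its contacts has
# at most `12 − k` contacts (crux `GenericWallFloor`, line `WallLedgerG`; fifth brick of the MERGE
# LOCALISATION of the stack ledger's residual `LOST`)

HONEST FRAMING. Part of the venture `Summits/Ventures/Crystal3D` (cell `crystal3d-full`), helper
`--supports` the crux `GenericWallFloor` (stmt-Ventures-19480) of `route-Ventures-StickyWulffConstant`,
registered line `WallLedgerG`, open stub `stub_twoSlabAdhesion` (general fillings).  The stack ledger needs,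
per end ball `y`, credit `(12 − deg y)/2 ≥ (number of walkers ending at y)/2`.  By `…StackWalkInjective` the
walkers ending at `y` are in bijection with the END STATES at `y`; each end state certifies a closed vertex
star of five contacts of `y` (`starSet`), distinct states have non-co-axial top lattices
(`…StackWalkStarExclusion` within a grain; the non-chain families across grains), hence their stars pairwise
COVER the contacts of `y` (that is the content of the certified input `DoubleStarCoaxialAt`, R39d) and are
pairwise different (two frames sharing two adjacent slots are co-axial, `coaxial_of_shared_adjacent_slots`).
This file turns that into the count:

* `card_add_card_le_twelve` — FINITE COMBINATORICS: a family of `k` distinct `5`-subsets of an `≤ 11`-set `N`,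
  any two of which cover `N`, has `|N| + k ≤ 12` (two cover ⇒ `|N| ≤ 10`; three ⇒ every point lies in two of
  them ⇒ `|N| ≤ 7`; six or more ⇒ the complements are disjoint ⇒ `k(|N| − 5) ≤ |N|`).
* `starSet`, `card_starSet`, `starSet_subset_contacts`, `star_owned_of_walkCertified`,
  `coaxial_of_starSet_eq` (equal stars ⇒ co-axial top lattices).
* **`card_contacts_add_card_le_twelve`** — at a ball `y` with `≤ 11` contacts in a `1`-separated `X`, a finite
  family of certified entries `(F, v)` whose stars pairwise cover the contacts of `y` and are pairwise
  different satisfies `deg y + #family ≤ 12`.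

WHAT THIS IS NOT: not the stub; the ledger assembly (non-chain pairs, inputs `ExactOnly` C12-55 and the
double-star inputs) is the next brick; F-C1 not moved.
-/

noncomputable section

namespace Summit.Ventures.Crystal3D.Theorems

open Finset
open Literature.MathematicalPhysics.StatisticalMechanics (fccStacking barlowStacking IsHaggSeq)
open scoped InnerProductSpace

variable {X : Finset (EuclideanSpace ℝ (Fin 3))}

/-! ### Finite combinatorics -/

/-- **Pairwise-covering 5-sets.**  `N` a finite set with `|N| ≤ 11`, `𝒮` a family of `5`-element subsets of
`N` any two (distinct) members of which cover `N`.  Then `|N| + |𝒮| ≤ 12`. -/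
theorem card_add_card_le_twelve {α : Type*} [DecidableEq α] (N : Finset α) (𝒮 : Finset (Finset α))
    (hN : N.card ≤ 11) (hsub : ∀ S ∈ 𝒮, S ⊆ N) (hcard : ∀ S ∈ 𝒮, S.card = 5)
    (hcov : ∀ S ∈ 𝒮, ∀ S' ∈ 𝒮, S ≠ S' → N ⊆ S ∪ S') : N.card + 𝒮.card ≤ 12 := by
  by_cases h1 : 𝒮.card ≤ 1
  · omega
  obtain ⟨S₁, hS₁, S₂, hS₂, hne⟩ := Finset.one_lt_card.1 (show 1 < 𝒮.card by omega)
  -- two members cover: `|N| ≤ 10`, and `|S₁ ∩ S₂| ≤ 10 − |N|`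
  have hU := hcov S₁ hS₁ S₂ hS₂ hne
  have hUI := Finset.card_union_add_card_inter S₁ S₂
  rw [hcard S₁ hS₁, hcard S₂ hS₂] at hUI
  have hNU : N.card ≤ (S₁ ∪ S₂).card := Finset.card_le_card hU
  have hN5 : 5 ≤ N.card := by rw [← hcard S₁ hS₁]; exact Finset.card_le_card (hsub S₁ hS₁)
  have hN6 : 6 ≤ N.card := by
    by_contra h
    have h5 : N.card = 5 := by omega
    have e₁ : S₁ = N := Finset.eq_of_subset_of_card_le (hsub S₁ hS₁) (by rw [hcard S₁ hS₁, h5])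
    have e₂ : S₂ = N := Finset.eq_of_subset_of_card_le (hsub S₂ hS₂) (by rw [hcard S₂ hS₂, h5])
    exact hne (e₁.trans e₂.symm)
  by_cases h2 : 𝒮.card ≤ 2
  · omega
  -- a third member: every point of `N` lies in two of the three, `|N| ≤ 7`
  obtain ⟨S₃, hS₃⟩ : ((𝒮.erase S₁).erase S₂).Nonempty := by
    rw [← Finset.card_pos, Finset.card_erase_of_mem (Finset.mem_erase.2 ⟨hne.symm, hS₂⟩),
      Finset.card_erase_of_mem hS₁]
    omega
  obtain ⟨h32, h3'⟩ := Finset.mem_erase.1 hS₃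
  obtain ⟨h31, hS₃𝒮⟩ := Finset.mem_erase.1 h3'
  have hN7 : N.card ≤ 7 := by
    have hsub3 : N ⊆ S₃ ∪ (S₁ ∩ S₂) := by
      intro x hx
      rw [Finset.mem_union, Finset.mem_inter]
      by_cases hx3 : x ∈ S₃
      · exact Or.inl hx3
      · right
        have h13 := hcov S₁ hS₁ S₃ hS₃𝒮 (Ne.symm h31) hx
        have h23 := hcov S₂ hS₂ S₃ hS₃𝒮 (Ne.symm h32) hx
        rw [Finset.mem_union] at h13 h23
        exact ⟨h13.resolve_right hx3, h23.resolve_right hx3⟩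
    have := (Finset.card_le_card hsub3).trans (Finset.card_union_le _ _)
    rw [hcard S₃ hS₃𝒮] at this
    omega
  by_cases h5 : 𝒮.card ≤ 5
  · omega
  -- six or more members: the complements `N \\ S` are pairwise disjoint subsets of `N`
  have hdisj : ∀ S ∈ 𝒮, ∀ S' ∈ 𝒮, S ≠ S' → Disjoint (N \ S) (N \ S') := by
    intro S hS S' hS' hSS'
    rw [Finset.disjoint_left]
    intro x hx hx'
    rw [Finset.mem_sdiff] at hx hx'
    have := hcov S hS S' hS' hSS' hx.1
    rw [Finset.mem_union] at this
    rcases this with h | h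
    · exact hx.2 h
    · exact hx'.2 h
  have hsum : ∑ S ∈ 𝒮, (N \ S).card ≤ N.card := by
    rw [← Finset.card_biUnion hdisj]
    exact Finset.card_le_card (Finset.biUnion_subset.2 fun S _ => Finset.sdiff_subset)
  have hconst : ∑ S ∈ 𝒮, (N \ S).card = 𝒮.card * (N.card - 5) :=
    Finset.sum_const_nat fun S hS => by rw [Finset.card_sdiff_of_subset (hsub S hS), hcard S hS]
  rw [hconst] at hsum
  rcases (by omega : N.card = 6 ∨ N.card = 7) with h | h <;> rw [h] at hsum ⊢ <;> omega

/-! ### Stars at a ball -/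

/-- The CLOSED VERTEX STAR of `−v` in the frame `F` at the ball `y`: the five points `y + F w`, `⟪w, v⟫ < 0`. -/
def starSet (y : EuclideanSpace ℝ (Fin 3)) (F : EuclideanSpace ℝ (Fin 3) ≃ₗᵢ[ℝ] EuclideanSpace ℝ (Fin 3))
    (v : EuclideanSpace ℝ (Fin 3)) : Finset (EuclideanSpace ℝ (Fin 3)) :=
  (fccSlots.filter fun w => ⟪w, v⟫_ℝ < 0).image fun w => y + F w

/-- A star has five points. -/
theorem card_starSet (y : EuclideanSpace ℝ (Fin 3)) (F : EuclideanSpace ℝ (Fin 3) ≃ₗᵢ[ℝ] EuclideanSpace ℝ (Fin 3))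
    {v : EuclideanSpace ℝ (Fin 3)} (hv : v ∈ fccSlots) : (starSet y F v).card = 5 := by
  classical
  unfold starSet
  rw [Finset.card_image_of_injective _ (fun a b h => F.injective (add_left_cancel h))]
  have e : (fccSlots.filter fun w => ⟪w, v⟫_ℝ < 0) = fccSlots.filter fun w => 0 < ⟪w, -v⟫_ℝ :=
    Finset.filter_congr fun w _ => by rw [inner_neg_right]; constructor <;> intro h <;> linarith
  rw [e]; exact card_star_eq_five (neg_mem_fccSlots hv)

/-- **A certified walker owns its star**: for the top entry `e` of a certified walker at `y`, every slot `w` with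
`⟪w, e.dir⟫ < 0` has `y + e.frame w ∈ X`. -/
theorem star_owned_of_walkCertified {y : EuclideanSpace ℝ (Fin 3)} {e : WalkEntry} (hdir : e.dir ∈ fccSlots)
    (hC : WalkCertified X y e) : ∀ w ∈ fccSlots, ⟪w, e.dir⟫_ℝ < 0 → y + e.frame w ∈ X := by
  obtain ⟨h₀, hstar⟩ := star_of_walkCertified hdir hC
  intro w hw hneg
  rcases inner_slots_mem hw hdir with h | h | h | h | h
  · rw [h] at hneg; norm_num at hneg
  · rw [h] at hneg; norm_num at hneg
  · rw [h] at hneg; exact absurd hneg (lt_irrefl 0)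
  · have hadj : w + e.dir ∈ fccSlots := add_mem_fccSlots_of_inner_eq_neg_half hw hdir h
    have hin : ⟪w + e.dir, e.dir⟫_ℝ = 1 / 2 := by
      rw [inner_add_left, h, real_inner_self_eq_norm_sq, norm_eq_one_of_mem_fccSlots hdir]; norm_num
    have := hstar _ hadj hin
    have e : y - e.frame e.dir + e.frame (w + e.dir) = y + e.frame w := by rw [map_add]; abel
    rwa [e] at this
  · have hw' : w = -e.dir := by
      have := eq_neg_of_inner_eq_neg_one hdir hw (by rw [real_inner_comm]; exact h)
      exact this
    rw [hw', map_neg, ← sub_eq_add_neg]; exact h₀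

/-- An owned star lies among the contacts of `y`. -/
theorem starSet_subset_contacts {y : EuclideanSpace ℝ (Fin 3)} (F : EuclideanSpace ℝ (Fin 3) ≃ₗᵢ[ℝ] EuclideanSpace ℝ (Fin 3))
    {v : EuclideanSpace ℝ (Fin 3)} (hown : ∀ w ∈ fccSlots, ⟪w, v⟫_ℝ < 0 → y + F w ∈ X) :
    starSet y F v ⊆ X.filter fun q => dist y q = 1 := by
  classical
  intro q hq
  unfold starSet at hq
  obtain ⟨w, hw, rfl⟩ := Finset.mem_image.1 hq
  obtain ⟨hw, hneg⟩ := Finset.mem_filter.1 hw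
  refine Finset.mem_filter.2 ⟨hown w hw hneg, ?_⟩
  rw [dist_self_add_right, LinearIsometryEquiv.norm_map, norm_eq_one_of_mem_fccSlots hw]

/-- **Equal stars force co-axial lattices** (the star of `−v` contains `−v` and a slot adjacent to it: two
adjacent shared unit vectors, `coaxial_of_shared_adjacent_slots`). -/
theorem coaxial_of_starSet_eq {y : EuclideanSpace ℝ (Fin 3)}
    {F₁ F₂ : EuclideanSpace ℝ (Fin 3) ≃ₗᵢ[ℝ] EuclideanSpace ℝ (Fin 3)} {v₁ v₂ : EuclideanSpace ℝ (Fin 3)}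
    (hv₁ : v₁ ∈ fccSlots) (h : starSet y F₁ v₁ = starSet y F₂ v₂) :
    ∃ (L : EuclideanSpace ℝ (Fin 3) ≃ₗᵢ[ℝ] EuclideanSpace ℝ (Fin 3))
      (s₁ s₂ : EuclideanSpace ℝ (Fin 3)) (σ σ' : ℤ → ℤ), IsHaggSeq σ ∧ IsHaggSeq σ' ∧
      F₁ '' fccStacking 1 (Real.sqrt (2 / 3)) ⊆ (fun p => L p + s₁) '' barlowStacking 1 (Real.sqrt (2 / 3)) σ ∧
      F₂ '' fccStacking 1 (Real.sqrt (2 / 3)) ⊆ (fun p => L p + s₂) '' barlowStacking 1 (Real.sqrt (2 / 3)) σ' := by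
  classical
  -- a second star slot `w ≠ −v₁`, adjacent to `−v₁`
  have h5 : 1 < (fccSlots.filter fun w => ⟪w, v₁⟫_ℝ < 0).card := by
    have := card_starSet y F₁ hv₁
    unfold starSet at this
    have hle := (Finset.card_image_le (s := fccSlots.filter fun w => ⟪w, v₁⟫_ℝ < 0) (f := fun w => y + F₁ w))
    omega
  obtain ⟨a, ha, b, hb, hab⟩ := Finset.one_lt_card.1 h5
  obtain ⟨ha, haneg⟩ := Finset.mem_filter.1 ha
  obtain ⟨hb, hbneg⟩ := Finset.mem_filter.1 hb
  -- one of them is not `−v₁`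
  obtain ⟨w, hw, hwneg, hwne⟩ : ∃ w ∈ fccSlots, ⟪w, v₁⟫_ℝ < 0 ∧ w ≠ -v₁ := by
    by_cases haw : a = -v₁
    · exact ⟨b, hb, hbneg, fun hbw => hab (haw.trans hbw.symm)⟩
    · exact ⟨a, ha, haneg, haw⟩
  have hwv : ⟪w, v₁⟫_ℝ = -(1 / 2) := by
    rcases inner_slots_mem hw hv₁ with h' | h' | h' | h' | h'
    · rw [h'] at hwneg; norm_num at hwneg
    · rw [h'] at hwneg; norm_num at hwneg
    · rw [h'] at hwneg; exact absurd hwneg (lt_irrefl 0)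
    · exact h'
    · exact absurd (eq_neg_of_inner_eq_neg_one hv₁ hw (by rw [real_inner_comm]; exact h')) hwne
  -- both `F₁(−v₁)` and `F₁ w` are star points, hence `F₂`-slot vectors
  have hmem : ∀ {s}, s ∈ fccSlots → ⟪s, v₁⟫_ℝ < 0 → F₁ s ∈ F₂ '' fccStacking 1 (Real.sqrt (2 / 3)) := by
    intro s hs hsneg
    have : y + F₁ s ∈ starSet y F₂ v₂ := by
      rw [← h]; unfold starSet; exact Finset.mem_image.2 ⟨s, Finset.mem_filter.2 ⟨hs, hsneg⟩, rfl⟩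
    unfold starSet at this
    obtain ⟨s', hs', he⟩ := Finset.mem_image.1 this
    exact ⟨s', mem_fcc_of_mem_fccSlots (Finset.mem_filter.1 hs').1, add_left_cancel he⟩
  have hnv : ⟪-v₁, v₁⟫_ℝ < 0 := by
    rw [inner_neg_left, real_inner_self_eq_norm_sq, norm_eq_one_of_mem_fccSlots hv₁]; norm_num
  have haff := coaxial_of_shared_adjacent_slots F₁ F₂ 0 0 (F₁ (-v₁)) (F₁ w)
    ⟨-v₁, mem_fcc_of_mem_fccSlots (neg_mem_fccSlots hv₁), rfl⟩ ⟨w, mem_fcc_of_mem_fccSlots hw, rfl⟩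
    (hmem (neg_mem_fccSlots hv₁) hnv) (hmem hw hwneg)
    (by rw [LinearIsometryEquiv.norm_map, norm_eq_one_of_mem_fccSlots (neg_mem_fccSlots hv₁)])
    (by rw [LinearIsometryEquiv.norm_map, norm_eq_one_of_mem_fccSlots hw])
    (by rw [LinearIsometryEquiv.inner_map_map, inner_neg_left, real_inner_comm, hwv]; norm_num)
  simpa only [add_zero] using haff

/-! ### The count at one ball -/

open scoped Classical in
/-- **`deg y + #stars ≤ 12`.**  `y` a ball with at most eleven contacts in `X`, `𝓟` a finite family of
pairs `(F, v)` (`v` a slot) whose closed stars at `y` are OWNED (`y + F w ∈ X` for `⟪w, v⟫ < 0`), pairwise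
DIFFERENT and pairwise COVERING the contacts of `y`.  Then `deg y + #𝓟 ≤ 12`. -/
theorem card_contacts_add_card_le_twelve
    {y : EuclideanSpace ℝ (Fin 3)} (hdeg : (X.filter fun q => dist y q = 1).card ≤ 11)
    (𝓟 : Finset ((EuclideanSpace ℝ (Fin 3) ≃ₗᵢ[ℝ] EuclideanSpace ℝ (Fin 3)) × EuclideanSpace ℝ (Fin 3)))
    (hslot : ∀ p ∈ 𝓟, p.2 ∈ fccSlots)
    (hown : ∀ p ∈ 𝓟, ∀ w ∈ fccSlots, ⟪w, p.2⟫_ℝ < 0 → y + p.1 w ∈ X)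
    (hdiff : ∀ p ∈ 𝓟, ∀ p' ∈ 𝓟, p ≠ p' → starSet y p.1 p.2 ≠ starSet y p'.1 p'.2)
    (hcov : ∀ p ∈ 𝓟, ∀ p' ∈ 𝓟, p ≠ p' →
      ∀ q ∈ X, dist y q = 1 → q ∈ starSet y p.1 p.2 ∪ starSet y p'.1 p'.2) :
    (X.filter fun q => dist y q = 1).card + 𝓟.card ≤ 12 := by
  set N := X.filter fun q => dist y q = 1 with hNdef
  set 𝒮 := 𝓟.image fun p => starSet y p.1 p.2 with h𝒮
  have hinj : Set.InjOn (fun p : (EuclideanSpace ℝ (Fin 3) ≃ₗᵢ[ℝ] EuclideanSpace ℝ (Fin 3)) × EuclideanSpace ℝ (Fin 3) =>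
      starSet y p.1 p.2) ↑𝓟 := by
    intro p hp p' hp' h
    by_contra hne
    exact hdiff p hp p' hp' hne h
  have hcard𝒮 : 𝒮.card = 𝓟.card := Finset.card_image_of_injOn hinj
  rw [← hcard𝒮]
  refine card_add_card_le_twelve N 𝒮 hdeg (fun S hS => ?_) (fun S hS => ?_) (fun S hS S' hS' hSS' => ?_)
  · obtain ⟨p, hp, rfl⟩ := Finset.mem_image.1 hS
    exact starSet_subset_contacts p.1 (hown p hp)
  · obtain ⟨p, hp, rfl⟩ := Finset.mem_image.1 hS
    exact card_starSet y p.1 (hslot p hp)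
  · obtain ⟨p, hp, rfl⟩ := Finset.mem_image.1 hS
    obtain ⟨p', hp', rfl⟩ := Finset.mem_image.1 hS'
    have hpp : p ≠ p' := fun h => hSS' (by rw [h])
    intro q hq
    obtain ⟨hqX, hqd⟩ := Finset.mem_filter.1 hq
    exact hcov p hp p' hp' hpp q hqX hqd

end Summit.Ventures.Crystal3D.Theorems

end
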